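import Summits.CriticalPhenomena.SAWScalingLimit.Theorems.SAWLeftRightFKGFKGToTraversalBoundCarveCore
import Summits.CriticalPhenomena.SAWScalingLimit.Theorems.SAWLeftRightFKGFKGToTraversalBoundDomBounded
import HarnessLib

/-!
# PA product over finitely many same-sided events (helper of stub `stub_collarAssembly`)

Crux `SAWLeftRightFKG.FKGToTraversalBound` (stmt-CriticalPhenomena-1878), line `gates-by-bubble-doors-by-fkg`,
registered helper `stub_paProduct` of STUB 4 (`stub_collarAssembly`, the access trichotomy): the last step of the
assembly chart — "far components behind distinct channels are SAME-SIDE pockets, so `LeftRightFKG` multiplies: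
`P(avoid all) ≥ Π_j (1 − p_j)`" — in partition-function form.

* `prod_le_inter_mul_pow_of_PA` — abstract: if a measure `w` is positively associated for a relation `le`
  (`w(A) w(B) ≤ w(univ) w(A ∩ B)` for `le`-up-closed `A, B`), then for every non-empty finite family of up-closed
  events `Π_i w(A_i) ≤ w(⋂_i A_i) · w(univ)^{n-1}` (induction; an intersection of up-closed sets is up-closed).
* `mul_le_univ_mul_inter_of_PA_down` — PA passes to DOWN-closed pairs when `w(univ) < ∞` (PA for the up-closed
  complements, split `w(A) = w(A ∩ B) + w(A ∖ B)`, `w(univ) = w(B) + w(Bᶜ)`, cancel the finite cross term — via the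
  landed complement form `inter_mul_univ_le_of_PA`, p85301).
* `stub_paProduct` — on the crux's own carriers `dom C δ` with the route's order `lrLE` and weight `SAW.weight`:
  under `LeftRightFKG`, for every non-empty finite family of events that are ALL `≼`-up-closed or ALL `≼`-down-closed,
  `Π_i Z(A_i) ≤ Z(⋂_i A_i) · Z^{n-1}` (finiteness of `Z` is free: `weight_dom_univ_ne_top`, p87093).

Only theorems; no named fact; axioms are the standard three.
-/

noncomputable section

open MeasureTheory Set
open scoped ENNReal
open Literature.Probability.LatticeModels Literature.Probability.RandomPlanarGeometry
open Summit.CriticalPhenomena.SAWScalingLimit.Theses.SAWLeftRightFKG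
open Summit.CriticalPhenomena.SAWScalingLimit.Theorems.FKGToTraversalBound.Negative (dom lrLE)
open Summit.CriticalPhenomena.SAWScalingLimit.Theorems.FKGToTraversalBound.ExcursionDomination
  (inter_mul_univ_le_of_PA weight_dom_univ_ne_top)

namespace Summit.CriticalPhenomena.SAWScalingLimit.Theorems.FKGToTraversalBound.GatesByBubbleDoorsByFKG

section Abstract

variable {ι α : Type*} [MeasurableSpace α] {le : α → α → Prop} {w : Measure α}

/-- **PA product, up-closed form.**  If `w` is positively associated for `le` (PA for `le`-up-closed pairs), then
for a non-empty finite family of `le`-up-closed events, `Π_{i ∈ s} w(A_i) ≤ w(⋂_{i ∈ s} A_i) · w(univ)^{|s|-1}`.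
[folklore] -/
theorem prod_le_inter_mul_pow_of_PA
    (hPA : ∀ A B : Set α, (∀ γ₁ γ₂, le γ₁ γ₂ → γ₁ ∈ A → γ₂ ∈ A) →
      (∀ γ₁ γ₂, le γ₁ γ₂ → γ₁ ∈ B → γ₂ ∈ B) → w A * w B ≤ w Set.univ * w (A ∩ B))
    (s : Finset ι) (A : ι → Set α) (hs : s.Nonempty)
    (hA : ∀ i ∈ s, ∀ γ₁ γ₂, le γ₁ γ₂ → γ₁ ∈ A i → γ₂ ∈ A i) :
    ∏ i ∈ s, w (A i) ≤ w (⋂ i ∈ s, A i) * w Set.univ ^ (s.card - 1) := by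
  classical
  induction s using Finset.induction_on with
  | empty => exact absurd hs Finset.not_nonempty_empty
  | @insert j t hj ih =>
    by_cases ht : t.Nonempty
    · have hAt : ∀ i ∈ t, ∀ γ₁ γ₂, le γ₁ γ₂ → γ₁ ∈ A i → γ₂ ∈ A i :=
        fun i hi => hA i (Finset.mem_insert_of_mem hi)
      have hAj : ∀ γ₁ γ₂, le γ₁ γ₂ → γ₁ ∈ A j → γ₂ ∈ A j := hA j (Finset.mem_insert_self j t)
      have hIt : ∀ γ₁ γ₂, le γ₁ γ₂ → γ₁ ∈ (⋂ i ∈ t, A i) → γ₂ ∈ (⋂ i ∈ t, A i) := by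
        intro γ₁ γ₂ hle h₁
        simp only [Set.mem_iInter] at h₁ ⊢
        exact fun i hi => hAt i hi γ₁ γ₂ hle (h₁ i hi)
      have key := hPA (A j) (⋂ i ∈ t, A i) hAj hIt
      have hcard : (insert j t).card - 1 = (t.card - 1) + 1 := by
        rw [Finset.card_insert_of_notMem hj]
        have := Finset.card_pos.2 ht
        omega
      rw [Finset.prod_insert hj, hcard, pow_succ, Finset.set_biInter_insert]
      calc w (A j) * ∏ i ∈ t, w (A i)
          ≤ w (A j) * (w (⋂ i ∈ t, A i) * w Set.univ ^ (t.card - 1)) := by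
            gcongr; exact ih ht hAt
        _ = (w (A j) * w (⋂ i ∈ t, A i)) * w Set.univ ^ (t.card - 1) := by ring
        _ ≤ (w Set.univ * w (A j ∩ ⋂ i ∈ t, A i)) * w Set.univ ^ (t.card - 1) := by
            gcongr
        _ = w (A j ∩ ⋂ i ∈ t, A i) * (w Set.univ ^ (t.card - 1) * w Set.univ) := by ring
    · have ht' : t = ∅ := Finset.not_nonempty_iff_eq_empty.1 ht
      subst ht'
      simp

/-- **PA for DOWN-closed pairs** from PA for up-closed pairs, when the total mass is finite: apply the complement
form `inter_mul_univ_le_of_PA` to the up-closed `Bᶜ` and the down-closed `A`, split `w(A) = w(A ∩ B) + w(A ∩ Bᶜ)`,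
`w(univ) = w(B) + w(Bᶜ)` and cancel the finite cross term. [folklore] -/
theorem mul_le_univ_mul_inter_of_PA_down
    (hPA : ∀ A B : Set α, (∀ γ₁ γ₂, le γ₁ γ₂ → γ₁ ∈ A → γ₂ ∈ A) →
      (∀ γ₁ γ₂, le γ₁ γ₂ → γ₁ ∈ B → γ₂ ∈ B) → w A * w B ≤ w Set.univ * w (A ∩ B))
    (hU : w Set.univ ≠ ⊤) {A B : Set α} (hAm : MeasurableSet A) (hBm : MeasurableSet B)
    (hA : ∀ γ₁ γ₂, le γ₁ γ₂ → γ₂ ∈ A → γ₁ ∈ A) (hB : ∀ γ₁ γ₂, le γ₁ γ₂ → γ₂ ∈ B → γ₁ ∈ B) :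
    w A * w B ≤ w Set.univ * w (A ∩ B) := by
  have hBc : ∀ γ₁ γ₂, le γ₁ γ₂ → γ₁ ∈ Bᶜ → γ₂ ∈ Bᶜ := fun γ₁ γ₂ h h₁ h₂ => h₁ (hB γ₁ γ₂ h h₂)
  -- complement form: `w(Bᶜ ∩ A) · w(univ) ≤ w(Bᶜ) · w(A)`
  have key := inter_mul_univ_le_of_PA (le := le) hPA hU hAm hBc hA
  have fin : ∀ S : Set α, w S ≠ ⊤ := fun S =>
    ((measure_mono (Set.subset_univ S)).trans_lt hU.lt_top).ne
  set p := w (A ∩ B) with hp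
  set q := w (A ∩ Bᶜ) with hq
  set β := w B with hβ
  set β' := w Bᶜ with hβ'
  have hAsplit : w A = p + q := by
    rw [hp, hq, ← Set.sdiff_eq]
    exact (measure_inter_add_sdiff A hBm).symm
  have hUsplit : w Set.univ = β + β' := by
    rw [hβ, hβ']
    exact (measure_add_measure_compl hBm).symm
  have hBA : w (Bᶜ ∩ A) = q := by rw [hq, Set.inter_comm]
  rw [hBA, hUsplit, hAsplit] at key
  -- `key : q * (β + β') ≤ β' * (p + q)`; cancel `q * β'`
  have h1 : q * β + q * β' ≤ β' * p + q * β' := by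
    calc q * β + q * β' = q * (β + β') := by ring
      _ ≤ β' * (p + q) := key
      _ = β' * p + q * β' := by ring
  have hqβ' : q * β' ≠ ⊤ := ENNReal.mul_ne_top (fin _) (fin _)
  have h2 : q * β ≤ β' * p := (ENNReal.add_le_add_iff_right hqβ').1 h1
  rw [hAsplit, hUsplit]
  calc (p + q) * β = p * β + q * β := by ring
    _ ≤ p * β + β' * p := add_le_add le_rfl h2
    _ = (β + β') * p := by ring

/-- **PA product, down-closed form** (finite total mass): for a non-empty finite family of `le`-down-closed
measurable events, `Π_{i ∈ s} w(A_i) ≤ w(⋂_{i ∈ s} A_i) · w(univ)^{|s|-1}`. [folklore] -/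
theorem prod_le_inter_mul_pow_of_PA_down
    (hPA : ∀ A B : Set α, (∀ γ₁ γ₂, le γ₁ γ₂ → γ₁ ∈ A → γ₂ ∈ A) →
      (∀ γ₁ γ₂, le γ₁ γ₂ → γ₁ ∈ B → γ₂ ∈ B) → w A * w B ≤ w Set.univ * w (A ∩ B))
    (hU : w Set.univ ≠ ⊤) (hm : ∀ S : Set α, MeasurableSet S)
    (s : Finset ι) (A : ι → Set α) (hs : s.Nonempty)
    (hA : ∀ i ∈ s, ∀ γ₁ γ₂, le γ₁ γ₂ → γ₂ ∈ A i → γ₁ ∈ A i) :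
    ∏ i ∈ s, w (A i) ≤ w (⋂ i ∈ s, A i) * w Set.univ ^ (s.card - 1) := by
  -- down-closed for `le` is up-closed for the flipped relation, for which PA holds by the previous lemma
  have hPA' : ∀ A B : Set α, (∀ γ₁ γ₂, (fun x y => le y x) γ₁ γ₂ → γ₁ ∈ A → γ₂ ∈ A) →
      (∀ γ₁ γ₂, (fun x y => le y x) γ₁ γ₂ → γ₁ ∈ B → γ₂ ∈ B) → w A * w B ≤ w Set.univ * w (A ∩ B) := by
    intro A B hA hB
    exact mul_le_univ_mul_inter_of_PA_down hPA hU (hm A) (hm B) (fun γ₁ γ₂ h h₂ => hA γ₂ γ₁ h h₂)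
      (fun γ₁ γ₂ h h₂ => hB γ₂ γ₁ h h₂)
  exact prod_le_inter_mul_pow_of_PA (le := fun x y => le y x) hPA' s A hs
    (fun i hi γ₁ γ₂ h h₁ => hA i hi γ₂ γ₁ h h₁)

end Abstract

/-- **PA PRODUCT for the route's order and weight** (registered helper `stub_paProduct` of STUB 4
`stub_collarAssembly`, crux stmt-CriticalPhenomena-1878): under `LeftRightFKG`, in every carrier of its class —
mesh `δ > 0`, boundary walk `C`, carrier `dom C δ`, endpoints `a ∼ a'`, `b ∼ b'` with `a', b'` vertices of `C` — for
every non-empty finite family of events `A_i` of chords that are ALL `≼`-up-closed or ALL `≼`-down-closed,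
`Π_i Z(A_i) ≤ Z(⋂_i A_i) · Z^{n-1}` for `Z(·) = SAW.weight (dom C δ) δ a b (·)`; i.e. for the law,
`P(⋂ A_i) ≥ Π P(A_i)` — positive association of same-side avoidances, the multiplying step of the access
trichotomy.  (`Z < ∞` by `weight_dom_univ_ne_top`; the σ-algebra on chords is discrete.) -/
theorem stub_paProduct : LeftRightFKG → ∀ (δ : ℝ) (c a b a' b' : Site 2) (C : (zdGraph 2).Walk c c), 0 < δ → a' ∈ C.support → b' ∈ C.support → (zdGraph 2).Adj a a' → (zdGraph 2).Adj b b' → ∀ (ι : Type) (s : Finset ι) (A : ι → Set (SAW.DomainSAW (dom C δ) δ a b)), s.Nonempty → ((∀ i ∈ s, ∀ γ₁ γ₂, lrLE γ₁ γ₂ → γ₁ ∈ A i → γ₂ ∈ A i) ∨ (∀ i ∈ s, ∀ γ₁ γ₂, lrLE γ₁ γ₂ → γ₂ ∈ A i → γ₁ ∈ A i)) → ∏ i ∈ s, SAW.weight (dom C δ) δ a b (A i) ≤ SAW.weight (dom C δ) δ a b (⋂ i ∈ s, A i) * SAW.weight (dom C δ) δ a b Set.univ ^ (s.card - 1) :=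 by
  intro hPA δ c a b a' b' C hδ ha' hb' haa hbb ι s A hs hside
  have hPAC := hPA δ c a b a' b' C hδ ha' hb' haa hbb
  rcases hside with hup | hdown
  · exact prod_le_inter_mul_pow_of_PA (le := lrLE (Ω := dom C δ) (δ := δ) (a := a) (b := b)) hPAC s A hs hup
  · exact prod_le_inter_mul_pow_of_PA_down (le := lrLE (Ω := dom C δ) (δ := δ) (a := a) (b := b)) hPAC
      (weight_dom_univ_ne_top C hδ a b) (fun _ => MeasurableSpace.measurableSet_top) s A hs hdown

end Summit.CriticalPhenomena.SAWScalingLimit.Theorems.FKGToTraversalBound.GatesByBubbleDoorsByFKG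

end
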